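import Summits.BirchSwinnertonDyer.Rank1Residual.Additive.KobayashiTowerPoints
import HarnessLib

/-!
# Route `ThetaPartnerAtTwo` (TP2), crux K3 `SignedKatoDivisibilityUpToAtTwo` (item stmt-BirchSwinnertonDyer-20308), line `colemanrat` —
# (R3) part 4a: the Galois conjugates of Kobayashi's `ℓ_N` in the tree's currency (`zeta p N ∈ ℚ̄_p`, `ell p N`)

Width seat `bsd-wall-tp2-p2x-w2` g5 (cell `bsd-wall`). HONEST FRAMING: theorems only (no definition, no named fact, no instance,
no `sorry`); local cyclotomic algebra; nothing about any curve is asserted; closes no item; K3 is NOT settled and BSD is NOT proved.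

## What is here

The generic (R3) theorems `HondaLogChi.sum_changeLevel_mul_ellConj(_eq_zero)` (`…HondaLogCharSumsEll`) evaluate
`∑_a χ(a)·σ_a(ℓ_N)` for the expression `σ_a(ℓ_N) := ∑_{k<N} (−1)^k ((ζ^{p^{2k}})^a − 1)/p^k` attached to ANY primitive `p^N`-th root
`ζ`. This file identifies that expression with the ACTUAL Galois conjugates of the tree's `ell p N` (the logarithm `Λ(c_N)` of Kobayashi's
tower point, `KobayashiTowerPoints.ptLogΩ_cPt`): for `σ ∈ Γ_{ℚ_p}` acting on `ζ_N = zeta p N` by `σ ζ_N = ζ_N^a`,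
**`σ • ell p N = ∑_{k<N} (−1)^k ((ζ_N^{p^{2k}})^a − 1)/p^k`** (`smul_ell_eq_ellConj`), using `ζ_{N−2k} = ζ_N^{p^{2k}}` (`zeta_pow_sq_pow`);
and every `σ` acts on `ζ_N` through some exponent `a` (`exists_smul_zeta_eq_pow`). With `KobayashiTowerPoints.ptLogΩ_act`
(`Λ(σ·Q) = σ • Λ(Q)`) this turns the character sums `∑ χ(u) Λ(u·c_N)` of logarithms of Galois conjugates of the tower points into the
generic sums of `…HondaLogCharSumsEll` with `ζ := zeta p N`.

References: [Kobayashi2003] §8.4 (p. 17), Prop. 8.26 (p. 24).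
-/

set_option autoImplicit false
-- the Theorems namespace of this sub repeats the summit name by design (D-0017 nested layout)
set_option linter.dupNamespace false

noncomputable section

open scoped Classical

open Finset Summit.BirchSwinnertonDyer.Rank1Residual.Additive Summit.BirchSwinnertonDyer.Rank1Residual.Additive.PadicCyclotomicTower
  Summit.BirchSwinnertonDyer.Rank1Residual.Additive.BallEval

namespace Summit.BirchSwinnertonDyer.BirchSwinnertonDyer.Theorems.SignedKatoOffTwo.HondaLogChi

variable {p : ℕ} [hp : Fact p.Prime]

/-- Every `σ ∈ Γ_{ℚ_p}` acts on the primitive `p^N`-th root `ζ_N = zeta p N` by `σ ζ_N = ζ_N^a` for some `a < p^N`. [folklore] -/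
theorem exists_smul_zeta_eq_pow (σ : Field.absoluteGaloisGroup ℚ_[p]) (N : ℕ) :
    ∃ a : ℕ, a < p ^ N ∧ σ • zeta p N = zeta p N ^ a := by
  have hζ := isPrimitiveRoot_zeta p N
  have hpow : (σ • zeta p N) ^ p ^ N = 1 := by
    rw [← smul_pow', hζ.pow_eq_one, smul_one]
  obtain ⟨a, ha, h⟩ := hζ.eq_pow_of_pow_eq_one hpow
  exact ⟨a, ha, h.symm⟩

/-- **The Galois conjugates of `ℓ_N`**: if `σ ζ_N = ζ_N^a` then
`σ • ell p N = ∑_{k<N} (−1)^k ((ζ_N^{p^{2k}})^a − 1)/p^k` (`ζ_{N−2k} = ζ_N^{p^{2k}}`), the expression `σ_a(ℓ_N)` of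
`HondaLogChi.sum_changeLevel_mul_ellConj` at `ζ := zeta p N`. [cite: Kobayashi2003, §8.4 (p. 17)] -/
theorem smul_ell_eq_ellConj {N a : ℕ} {σ : Field.absoluteGaloisGroup ℚ_[p]} (hσ : σ • zeta p N = zeta p N ^ a) :
    σ • ell p N = ∑ k ∈ range N, (-1) ^ k * ((zeta p N ^ p ^ (2 * k)) ^ a - 1) / (p : PadicAlgCl p) ^ k := by
  rw [ell, Finset.smul_sum]
  refine Finset.sum_congr rfl fun k _ ↦ ?_
  rw [← zeta_pow_sq_pow, Field.absoluteGaloisGroup.smul_def]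
  simp only [map_div₀, map_mul, map_pow, map_neg, map_one, map_sub, map_natCast]
  rw [← Field.absoluteGaloisGroup.smul_def, hσ, ← pow_mul, ← pow_mul, Nat.mul_comm a]

/-- The conjugate expression does not depend on the choice of the exponent: it only depends on `σ ζ_N`. (Restatement of
`smul_ell_eq_ellConj` with the exponent produced by `exists_smul_zeta_eq_pow`.) [cite: Kobayashi2003, §8.4 (p. 17)] -/
theorem exists_smul_ell_eq_ellConj (σ : Field.absoluteGaloisGroup ℚ_[p]) (N : ℕ) :
    ∃ a : ℕ, a < p ^ N ∧ σ • zeta p N = zeta p N ^ a ∧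
      σ • ell p N = ∑ k ∈ range N, (-1) ^ k * ((zeta p N ^ p ^ (2 * k)) ^ a - 1) / (p : PadicAlgCl p) ^ k := by
  obtain ⟨a, ha, hσ⟩ := exists_smul_zeta_eq_pow σ N
  exact ⟨a, ha, hσ, smul_ell_eq_ellConj hσ⟩

end Summit.BirchSwinnertonDyer.BirchSwinnertonDyer.Theorems.SignedKatoOffTwo.HondaLogChi

end
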